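import Mathlib
import Summits.Ventures.PercRepro.PuncturedLYMSplitOneCoHyp

/-!
# PercRepro — THE EXACT CRITERION FOR ONE DECORATED MEMBER: NECESSITY
(p10, gen 37)

If the one-member instance (rows `rowsOne S ℓ C`, member columns `⊇ C` at demand `1`, any demands elsewhere, uniform
row mass `ρ`) has a flow, then `m·ρ ≥ 1`: the member columns are paid only by the rows below them, every such row is
`Y ∖ c` for a point `c ∈ C` (at most `m` rows per member column), and a row pays at most `ρ` in total.  Together with
`hasFlow_rowsOne_decorated` (PuncturedLYMFibrationOne) the decorated one-member instance is feasible IFF `m·ρ ≥ 1`.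
-/

namespace PercRepro.PuncturedLYM.Split

open Finset

variable {α : Type} [DecidableEq α]

/-- The rows below a member column `Y ⊇ C` are among the `Y ∖ c`, `c ∈ C`. -/
theorem subs_rowsOne_subset_image {S C Y : Finset α} {ℓ : ℕ} (hCY : C ⊆ Y) (hYc : Y.card = ℓ + 1) :
    subs (rowsOne S ℓ C) Y ⊆ C.image (fun c => Y.erase c) := by
  intro X hX
  rw [mem_subs, mem_rowsOne] at hX
  obtain ⟨⟨_, hXc, hCX⟩, hXY⟩ := hX
  have hc : (Y \ X).card = 1 := by rw [card_sdiff_of_subset hXY, hYc, hXc]; omega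
  obtain ⟨y, hy⟩ := card_eq_one.1 hc
  have hyY : y ∈ Y := (mem_sdiff.1 (hy ▸ mem_singleton_self y)).1
  have hyX : y ∉ X := (mem_sdiff.1 (hy ▸ mem_singleton_self y)).2
  have hXeq : X = Y.erase y := by
    ext z
    rw [mem_erase]
    constructor
    · intro hz; exact ⟨fun h => hyX (h ▸ hz), hXY hz⟩
    · rintro ⟨hzy, hzY⟩
      by_contra hzX
      have : z ∈ Y \ X := mem_sdiff.2 ⟨hzY, hzX⟩
      rw [hy, mem_singleton] at this
      exact hzy this
  have hyC : y ∈ C := by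
    by_contra hyC
    apply hCX
    intro c hc'
    have : c ∈ Y := hCY hc'
    rw [hXeq, mem_erase]
    exact ⟨fun h => hyC (h ▸ hc'), this⟩
  rw [mem_image]
  exact ⟨y, hyC, hXeq.symm⟩

/-- **NECESSITY.** A flow of the one-member instance with member columns at demand `1` forces `m·ρ ≥ 1`
(at least one member column). -/
theorem one_le_mul_of_hasFlow_rowsOne {S C : Finset α} {ℓ : ℕ}
    {ρ : ℚ} {ν : Finset α → ℚ} (hν : ∀ Y ∈ cols S ℓ, C ⊆ Y → ν Y = 1)
    (hMC : ((cols S ℓ).filter (fun Y => C ⊆ Y)).Nonempty)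
    (h : HasFlow S ℓ (rowsOne S ℓ C) (fun _ => ρ) ν) : 1 ≤ (C.card : ℚ) * ρ := by
  obtain ⟨w, hw⟩ := h
  set MC := (cols S ℓ).filter (fun Y => C ⊆ Y) with hMC_def
  set AR := (rowsOne S ℓ C).filter (fun X => ∃ Y ∈ MC, X ⊆ Y) with hAR_def
  -- the member columns' demand, as a double sum
  have h1 : (MC.card : ℚ) = ∑ Y ∈ MC, ∑ X ∈ subs (rowsOne S ℓ C) Y, w X Y := by
    rw [card_eq_sum_ones, Nat.cast_sum]
    apply sum_congr rfl
    intro Y hY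
    rw [mem_filter] at hY
    rw [hw.col Y hY.1, hν Y hY.1 hY.2]
    simp
  -- swap the sums: over the rows that lie below a member column
  have h2 : ∑ Y ∈ MC, ∑ X ∈ subs (rowsOne S ℓ C) Y, w X Y
      = ∑ X ∈ AR, ∑ Y ∈ MC.filter (fun Y => X ⊆ Y), w X Y := by
    rw [sum_comm' (t' := AR) (s' := fun X => MC.filter (fun Y => X ⊆ Y))]
    intro Y X
    simp only [mem_subs, hAR_def, mem_filter]
    constructor
    · rintro ⟨hY, hXP, hXY⟩; exact ⟨⟨hY, hXY⟩, hXP, Y, hY, hXY⟩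
    · rintro ⟨⟨hY, hXY⟩, hXP, _⟩; exact ⟨hY, hXP, hXY⟩
  -- each row pays at most `ρ` into the member columns
  have h3 : ∀ X ∈ AR, ∑ Y ∈ MC.filter (fun Y => X ⊆ Y), w X Y ≤ ρ := by
    intro X hX
    rw [hAR_def, mem_filter] at hX
    rw [← hw.row X hX.1]
    apply sum_le_sum_of_subset_of_nonneg
    · intro Y hY
      rw [mem_filter, hMC_def, mem_filter, mem_cols] at hY
      obtain ⟨⟨⟨hYS, hYc⟩, _⟩, hXY⟩ := hY
      have hXc : X.card = ℓ := (mem_rowsOne.1 hX.1).2.1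
      have hc : (Y \ X).card = 1 := by rw [card_sdiff_of_subset hXY, hYc, hXc]; omega
      obtain ⟨y, hy⟩ := card_eq_one.1 hc
      have hyY : y ∈ Y := (mem_sdiff.1 (hy ▸ mem_singleton_self y)).1
      have hyX : y ∉ X := (mem_sdiff.1 (hy ▸ mem_singleton_self y)).2
      rw [mem_sups]
      refine ⟨y, hYS hyY, hyX, ?_⟩
      ext z
      rw [mem_insert]
      constructor
      · intro hz
        by_cases hzX : z ∈ X
        · exact Or.inr hzX
        · have : z ∈ Y \ X := mem_sdiff.2 ⟨hz, hzX⟩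
          rw [hy, mem_singleton] at this
          exact Or.inl this
      · rintro (rfl | hz)
        · exact hyY
        · exact hXY hz
    · intro Y _ _; exact hw.nonneg X Y
  -- at most `m` rows below each member column
  have h4 : AR.card ≤ C.card * MC.card := by
    have hsub : AR ⊆ MC.biUnion (fun Y => subs (rowsOne S ℓ C) Y) := by
      intro X hX
      rw [hAR_def, mem_filter] at hX
      obtain ⟨hXP, Y, hY, hXY⟩ := hX
      rw [mem_biUnion]
      exact ⟨Y, hY, mem_subs.2 ⟨hXP, hXY⟩⟩
    calc AR.card ≤ (MC.biUnion (fun Y => subs (rowsOne S ℓ C) Y)).card := card_le_card hsub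
      _ ≤ ∑ Y ∈ MC, (subs (rowsOne S ℓ C) Y).card := card_biUnion_le
      _ ≤ ∑ Y ∈ MC, C.card := by
          apply sum_le_sum
          intro Y hY
          rw [hMC_def, mem_filter, mem_cols] at hY
          calc (subs (rowsOne S ℓ C) Y).card ≤ (C.image (fun c => Y.erase c)).card :=
                card_le_card (subs_rowsOne_subset_image hY.2 hY.1.2)
            _ ≤ C.card := card_image_le
      _ = C.card * MC.card := by rw [sum_const, smul_eq_mul, mul_comm]
  have hMCpos : (0 : ℚ) < MC.card := by exact_mod_cast card_pos.2 hMC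
  have h5 : (MC.card : ℚ) ≤ ρ * AR.card := by
    rw [h1, h2]
    calc ∑ X ∈ AR, ∑ Y ∈ MC.filter (fun Y => X ⊆ Y), w X Y ≤ ∑ X ∈ AR, ρ := sum_le_sum h3
      _ = ρ * AR.card := by rw [sum_const, nsmul_eq_mul, mul_comm]
  have hρ : 0 ≤ ρ := by
    by_contra hneg
    push Not at hneg
    have : ρ * AR.card ≤ 0 := mul_nonpos_of_nonpos_of_nonneg hneg.le (by positivity)
    linarith
  have h6 : (AR.card : ℚ) ≤ C.card * MC.card := by exact_mod_cast h4
  have h7 : (MC.card : ℚ) ≤ ρ * (C.card * MC.card) := le_trans h5 (mul_le_mul_of_nonneg_left h6 hρ)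
  have : (1 : ℚ) * MC.card ≤ (C.card * ρ) * MC.card := by linarith [h7]
  exact le_of_mul_le_mul_right this hMCpos

end PercRepro.PuncturedLYM.Split
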